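import Summits.AtomisticToContinuum.HydrodynamicLimit.Theorems.JParityClosureLocalSecondLawInitialLayerLLN
import Summits.AtomisticToContinuum.HydrodynamicLimit.Theorems.DenseExcursion.Negative.AtTimeZero

/-!
# Stub B (`stub_initialLayer`) of the entropy-ledger line for `JParityClosure.LocalSecondLaw`
(stmt-AtomisticToContinuum-13081, line `exact-entropy-ledger-three-passivities`)

The initial layer: in the crux's frame at `t = 0`, given the equation-of-state band `EosBand η₀ F`, for continuous
profiles, `σ < σ₀(profiles, η₀)`, a classical hard-sphere Euler solution TIED to the local Gibbs data by the `t = 0`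
law of large numbers, and a smooth non-negative space–time test function `φ`, the Euler boundary term dominates the
particle one up to `η` off an event of probability `≤ δ`:
`P( ∫ H(ρ(0),θ(0)) φ(0) < ∫ H(ρ_r(Φ₀ z), θ_r(Φ₀ z)) φ(0) - η ) ≤ δ` for `r < r₀` and `N ≥ N₀(r)`.

Proof.
* `σ₀`: below the statics threshold of `DenseExcursionAtTimeZero.density_zero_eq_rhoLim` the tie pins the Euler
  density at `t = 0` to the cluster-series density `rhoLim`, which is `< (2e+1)M` uniformly in `σ`
  (`DenseExcursionAtTimeZero.rhoLim_lt`); for `σ < σ₀ := σ₁ ∧ 1 ∧ η₀/((2e+1)M)` the datum has `ρ(0,x) σ³ < η₀`.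
* Modulus (`initL_modulus`): `(a, m, e) ↦ Hs σ a (2/3 (e/a - |m|²/(2a²)))` is continuous on the OPEN region
  `{a > 0, a σ³ < η₀, θ > 0}` (guard off, `f_ex = F` continuous by `EosBand`), which contains the compact data curve
  `x ↦ (ρ, ρu, E)(0, x)`; a compact `cthickening` inside the region and Heine–Cantor (`initL_unif_near_compact`) give:
  cone fields `ε₃`-close to the data at every `x` ⇒ entropy densities `ε₄`-close at every `x`, and the particle
  integrand is continuous (hence Bochner-integrable on the compact torus).
* The uniform LLN `initialLayer_uniformLLN` (`Theorems/JParityClosureLocalSecondLawInitialLayerLLN.lean`) supplies the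
  `ε₃`-closeness off an event of probability `≤ δ`; there `|bdry - init| ≤ ε₄ ∫ φ(0) < η` with
  `ε₄ = η/(∫ φ(0) + 1)`, so the stub's event lies in the bad event (`measure_mono`).

References: H. Spohn, *Large Scale Dynamics of Interacting Particles* (1991), Part I §2.3–§3 (local equilibrium and
the statics of the hard-sphere gas at small density).
-/

noncomputable section

namespace Summit.AtomisticToContinuum.HydrodynamicLimit.Theorems.LocalSecondLawLedger

open scoped BigOperators Topology Classical MeasureTheory ENNReal InnerProductSpace
open Filter Set MeasureTheory
open Literature.MathematicalPhysics.KineticTheory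
open Literature.Analysis.FluidPDE
open Summit.AtomisticToContinuum.HydrodynamicLimit.Theorems.LocalSecondLawNegative

variable {N : ℕ}

/-! ## The entropy density near the Euler data: continuity and uniform modulus -/

/-- Uniform continuity near a compact set: if `g` is continuous on an open `U ⊇ K`, `K` compact (proper space),
then for every `ε > 0` there is `δ > 0` such that every point within `δ` of a point `p ∈ K` lies in `U` and has
`g`-value within `ε` of `g p` (a compact `cthickening` of `K` inside `U`, Heine–Cantor on it). -/
theorem initL_unif_near_compact {X Y : Type*} [PseudoMetricSpace X] [ProperSpace X] [PseudoMetricSpace Y]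
    {g : X → Y} {U K : Set X} (hU : IsOpen U) (hK : IsCompact K) (hKU : K ⊆ U) (hg : ContinuousOn g U)
    {ε : ℝ} (hε : 0 < ε) :
    ∃ δ : ℝ, 0 < δ ∧ ∀ p ∈ K, ∀ q, dist q p < δ → q ∈ U ∧ dist (g q) (g p) < ε := by
  obtain ⟨δ₁, hδ₁, h₁⟩ := hK.exists_cthickening_subset_open hU hKU
  obtain ⟨δ₂, hδ₂, h₂⟩ := Metric.uniformContinuousOn_iff.1
    ((hK.cthickening (r := δ₁)).uniformContinuousOn_of_continuous (hg.mono h₁)) ε hε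
  refine ⟨min δ₁ δ₂, lt_min hδ₁ hδ₂, fun p hp q hq => ?_⟩
  have hqK : q ∈ Metric.cthickening δ₁ K :=
    Metric.mem_cthickening_of_dist_le q p δ₁ K hp (hq.le.trans (min_le_left _ _))
  exact ⟨h₁ hqK, h₂ q hqK p (Metric.self_subset_cthickening K hp) (hq.trans_le (min_le_right _ _))⟩

/-- The coarse-temperature map `(a, m, e) ↦ 2/3 (e/a - |m|²/(2a²))` is continuous away from `a = 0`. -/
theorem initL_continuousAt_theta {p : ℝ × V3 × ℝ} (hp : p.1 ≠ 0) :
    ContinuousAt (fun q : ℝ × V3 × ℝ => 2 / 3 * (q.2.2 / q.1 - ‖q.2.1‖ ^ 2 / (2 * q.1 ^ 2))) p := by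
  have h2 : (2 : ℝ) * p.1 ^ 2 ≠ 0 := mul_ne_zero two_ne_zero (pow_ne_zero 2 hp)
  exact continuousAt_const.mul ((continuous_snd.snd.continuousAt.div continuous_fst.continuousAt hp).sub
    (((continuous_norm.comp continuous_snd.fst).pow 2).continuousAt.div
      (continuous_const.mul (continuous_fst.pow 2)).continuousAt h2))

/-- The regular region `{a > 0, a σ³ < η₀, θ(a,m,e) > 0}` of the state space is open. -/
theorem initL_isOpen_U (η₀ σ : ℝ) :
    IsOpen {p : ℝ × V3 × ℝ | 0 < p.1 ∧ p.1 * σ ^ 3 < η₀ ∧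
      0 < 2 / 3 * (p.2.2 / p.1 - ‖p.2.1‖ ^ 2 / (2 * p.1 ^ 2))} := by
  refine isOpen_iff_mem_nhds.2 fun p hp => ?_
  have h1 : {q : ℝ × V3 × ℝ | 0 < q.1} ∈ 𝓝 p := (isOpen_lt continuous_const continuous_fst).mem_nhds hp.1
  have h2 : {q : ℝ × V3 × ℝ | q.1 * σ ^ 3 < η₀} ∈ 𝓝 p :=
    (isOpen_lt (continuous_fst.mul continuous_const) continuous_const).mem_nhds hp.2.1
  have h3 : (fun q : ℝ × V3 × ℝ => 2 / 3 * (q.2.2 / q.1 - ‖q.2.1‖ ^ 2 / (2 * q.1 ^ 2))) ⁻¹' Set.Ioi 0 ∈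
      𝓝 p :=
    (initL_continuousAt_theta hp.1.ne').preimage_mem_nhds (isOpen_Ioi.mem_nhds hp.2.2)
  filter_upwards [h1, h2, h3] with q hq1 hq2 hq3
  exact ⟨hq1, hq2, hq3⟩

/-- **The guarded entropy density is continuous on the regular region.** On `{a > 0, a σ³ < η₀, θ > 0}` the guard
of `Hs` is off and `f_ex(a σ³) = F(a σ³)` with `F` analytic on `(-η₀, η₀)` (`EosBand`), so
`(a, m, e) ↦ Hs σ a θ(a,m,e)` is continuous there. -/
theorem initL_continuousOn_Hs {η₀ σ : ℝ} {F : ℝ → ℝ} (hB : EosBand η₀ F) (hσ : 0 < σ) :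
    ContinuousOn (fun p : ℝ × V3 × ℝ => Hs σ p.1 (2 / 3 * (p.2.2 / p.1 - ‖p.2.1‖ ^ 2 / (2 * p.1 ^ 2))))
      {p : ℝ × V3 × ℝ | 0 < p.1 ∧ p.1 * σ ^ 3 < η₀ ∧
        0 < 2 / 3 * (p.2.2 / p.1 - ‖p.2.1‖ ^ 2 / (2 * p.1 ^ 2))} := by
  set θf : ℝ × V3 × ℝ → ℝ := fun p => 2 / 3 * (p.2.2 / p.1 - ‖p.2.1‖ ^ 2 / (2 * p.1 ^ 2))
  set U : Set (ℝ × V3 × ℝ) := {p | 0 < p.1 ∧ p.1 * σ ^ 3 < η₀ ∧ 0 < θf p}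
  have hθc : ContinuousOn θf U :=
    continuousOn_of_forall_continuousAt fun p hp => initL_continuousAt_theta hp.1.ne'
  have hF : ContinuousOn (fun p : ℝ × V3 × ℝ => F (p.1 * σ ^ 3)) U := by
    refine hB.2.1.continuousOn.comp (continuous_fst.mul continuous_const).continuousOn fun p hp => ?_
    exact ⟨by linarith [hB.1, mul_pos hp.1 (pow_pos hσ 3)], hp.2.1⟩
  have hformula : ContinuousOn (fun p : ℝ × V3 × ℝ =>
      -(p.1 * (3 / 2 * Real.log (θf p) - Real.log p.1 - F (p.1 * σ ^ 3)))) U :=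
    (continuous_fst.continuousOn.mul (((continuousOn_const.mul (hθc.log fun p hp => hp.2.2.ne')).sub
      (continuous_fst.continuousOn.log fun p hp => hp.1.ne')).sub hF)).neg
  refine hformula.congr fun p hp => ?_
  show Hs σ p.1 (θf p) = -(p.1 * (3 / 2 * Real.log (θf p) - Real.log p.1 - F (p.1 * σ ^ 3)))
  unfold Hs
  rw [if_pos ⟨hp.1, hp.2.2⟩, hB.2.2 ⟨(mul_pos hp.1 (pow_pos hσ 3)).le, hp.2.1⟩]

/-- The coarse-temperature map returns the temperature on the Euler data: `θ(ρ, ρu, ρ(|u|²/2 + 3θ/2)) = θ`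
for `ρ > 0`. -/
theorem initL_theta_datum {a t : ℝ} (ha : 0 < a) (v : V3) :
    2 / 3 * (totalEnergyDensity a v t / a - ‖a • v‖ ^ 2 / (2 * a ^ 2)) = t := by
  unfold totalEnergyDensity
  rw [norm_smul, Real.norm_eq_abs, abs_of_pos ha]
  field_simp
  ring

/-- **Uniform modulus of the entropy density near the Euler data.** For data `(ρ₀, u₀, θ₀)` continuous with
`ρ₀, θ₀ > 0` and `ρ₀ σ³ < η₀` (inside the EOS band): `x ↦ Hs σ (ρ₀ x) (θ₀ x)` is continuous, and for every
`ε₄ > 0` there is `ε₃ > 0` such that for every configuration whose three cone fields are `ε₃`-close to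
`(ρ₀, ρ₀u₀, E₀)` at every centre, the particle entropy density `x ↦ Hs σ (ρ_r x) (θ_r x)` is continuous and
`ε₄`-close to `Hs σ (ρ₀ x) (θ₀ x)` at every `x`. -/
theorem initL_modulus {η₀ σ : ℝ} {F : ℝ → ℝ} (hB : EosBand η₀ F) (hσ : 0 < σ)
    {ρ0 θ0 : T3 → ℝ} {u0 : T3 → V3} (hρc : Continuous ρ0) (huc : Continuous u0) (hθc : Continuous θ0)
    (hρpos : ∀ x, 0 < ρ0 x) (hθpos : ∀ x, 0 < θ0 x) (hband : ∀ x, ρ0 x * σ ^ 3 < η₀)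
    {ε₄ : ℝ} (hε₄ : 0 < ε₄) :
    Continuous (fun x => Hs σ (ρ0 x) (θ0 x)) ∧
    ∃ ε₃ : ℝ, 0 < ε₃ ∧ ∀ (n : ℕ) (r : ℝ) (w : Phase n),
      (∀ x, |rhoC r w x - ρ0 x| < ε₃ ∧ ‖momC r w x - ρ0 x • u0 x‖ < ε₃ ∧
        |kinC r w x - totalEnergyDensity (ρ0 x) (u0 x) (θ0 x)| < ε₃) →
      Continuous (fun x => Hs σ (rhoC r w x) (thetaC r w x)) ∧
      ∀ x, |Hs σ (rhoC r w x) (thetaC r w x) - Hs σ (ρ0 x) (θ0 x)| < ε₄ := by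
  set θf : ℝ × V3 × ℝ → ℝ := fun p => 2 / 3 * (p.2.2 / p.1 - ‖p.2.1‖ ^ 2 / (2 * p.1 ^ 2))
  set G : ℝ × V3 × ℝ → ℝ := fun p => Hs σ p.1 (θf p)
  set U : Set (ℝ × V3 × ℝ) := {p | 0 < p.1 ∧ p.1 * σ ^ 3 < η₀ ∧ 0 < θf p}
  set D : T3 → ℝ × V3 × ℝ := fun x => (ρ0 x, ρ0 x • u0 x, totalEnergyDensity (ρ0 x) (u0 x) (θ0 x))
    with hD
  have hDc : Continuous D := by
    simp only [hD, totalEnergyDensity]; fun_prop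
  have hθD : ∀ x, θf (D x) = θ0 x := fun x => initL_theta_datum (hρpos x) (u0 x)
  have hGD : ∀ x, G (D x) = Hs σ (ρ0 x) (θ0 x) := fun x => by
    show Hs σ (ρ0 x) (θf (D x)) = _
    rw [hθD x]
  have hDU : ∀ x, D x ∈ U := fun x => ⟨hρpos x, hband x, by rw [hθD x]; exact hθpos x⟩
  have hKU : Set.range D ⊆ U := by
    rintro _ ⟨x, rfl⟩
    exact hDU x
  have hUo : IsOpen U := initL_isOpen_U η₀ σ
  have hGc : ContinuousOn G U := initL_continuousOn_Hs hB hσ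
  have hGDc : Continuous fun x => G (D x) := hGc.comp_continuous hDc hDU
  refine ⟨by simpa only [hGD] using hGDc, ?_⟩
  obtain ⟨ε₃, hε₃, H3⟩ := initL_unif_near_compact hUo (isCompact_range hDc) hKU hGc hε₄
  refine ⟨ε₃, hε₃, fun n r w hw => ?_⟩
  have hq : ∀ x, (rhoC r w x, momC r w x, kinC r w x) ∈ U ∧
      |G (rhoC r w x, momC r w x, kinC r w x) - G (D x)| < ε₄ := by
    intro x
    obtain ⟨h1, h2, h3⟩ := hw x
    have hd : dist (rhoC r w x, momC r w x, kinC r w x) (D x) < ε₃ := by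
      rw [Prod.dist_eq, max_lt_iff, Prod.dist_eq, max_lt_iff, Real.dist_eq, dist_eq_norm, Real.dist_eq]
      exact ⟨h1, h2, h3⟩
    have h := H3 (D x) ⟨x, rfl⟩ _ hd
    exact ⟨h.1, by rw [← Real.dist_eq]; exact h.2⟩
  have hqc : Continuous fun x => (rhoC r w x, momC r w x, kinC r w x) :=
    (initL_continuous_rhoC r w).prodMk ((initL_continuous_momC r w).prodMk (continuous_kinC r w))
  have hGq : Continuous fun x => G (rhoC r w x, momC r w x, kinC r w x) :=
    hGc.comp_continuous hqc fun x => (hq x).1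
  refine ⟨hGq, fun x => ?_⟩
  rw [← hGD x]
  exact (hq x).2

/-! ## The stub -/

/-- **Stub B · initial layer** (`stub_initialLayer`, registered verbatim). In the crux's frame at `t = 0`: given
the EOS band, for profiles, `σ < σ₀(profiles, η₀)`, a classical hs-Euler solution TIED to the data by the `t = 0`
LLN, and a smooth non-negative space–time test function, the Euler boundary term dominates the particle one up to
`η`: `P( ∫H(ρ(0),θ(0))φ(0) < ∫H(ρ_r(Φ₀z),θ_r(Φ₀z))φ(0) − η ) ≤ δ` for `r < r₀`, `N ≥ N₀(r)`. Proof: data pinning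
(`density_zero_eq_rhoLim`, `rhoLim_lt`) puts the datum inside the band for `σ < σ₀`; the uniform LLN
(`initialLayer_uniformLLN`) and the uniform modulus of the entropy density (`initL_modulus`) make the two boundary
integrands `η/(∫φ(0)+1)`-close at every `x` off an event of probability `≤ δ`, whence `|bdry - init| < η` there. -/
theorem stub_initialLayer :
  ∀ (η₀ : ℝ) (F : ℝ → ℝ), EosBand η₀ F →
  ∀ (a₀ θ₀ : T3 → ℝ) (u₀ : T3 → V3), Continuous a₀ → Continuous θ₀ → Continuous u₀ →
    (∀ x, 0 < a₀ x) → (∀ x, 0 < θ₀ x) → ∃ σ₀ : ℝ, 0 < σ₀ ∧ ∀ σ : ℝ, 0 < σ → σ < σ₀ →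
    ∀ (T : ℝ) (ρ θ : ℝ → T3 → ℝ) (u : ℝ → T3 → V3), IsHardSphereEulerSolution σ T ρ u θ →
    ∀ Φ : (N : ℕ) → Flow σ N,
    TendstoHydroFieldsAt (fun N => localGibbsLaw σ a₀ u₀ θ₀ N (Φ N)) Φ ρ u θ 0 → 0 < T →
    ∀ φ : ℝ → T3 → ℝ, Literature.Analysis.FunctionSpaces.Torus.IsSmoothSpaceTimeOn Set.univ φ →
    (∀ s x, 0 ≤ φ s x) →
    ∀ η δ : ℝ, 0 < η → 0 < δ → ∃ r₀ : ℝ, 0 < r₀ ∧ ∀ r : ℝ, 0 < r → r < r₀ → ∃ N₀ : ℕ, ∀ N : ℕ, N₀ ≤ N →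
      localGibbsLaw σ a₀ u₀ θ₀ N (Φ N)
          {z | (∫ x : T3, Hs σ (ρ 0 x) (θ 0 x) * φ 0 x) < bdry σ r (φ 0) (Φ N) z - η}
        ≤ ENNReal.ofReal δ := by
  intro η₀ F hB a₀ θ₀ u₀ ha hθ hu ha0 hθ0
  obtain ⟨σ₁, hσ₁, -, G1⟩ :=
    DenseExcursionAtTimeZero.density_zero_eq_rhoLim (u₀ := u₀) ha hθ hu ha0 hθ0
  set A : ℝ := (2 * Real.exp 1 + 1) * (profileOf a₀ ha ha0).M
  have hApos : 0 < A := by have := (profileOf a₀ ha ha0).M_pos; positivity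
  have hη₀ : 0 < η₀ := hB.1
  refine ⟨min σ₁ (min 1 (η₀ / A)), lt_min hσ₁ (lt_min one_pos (div_pos hη₀ hApos)), ?_⟩
  intro σ hσ hσlt T ρ θ u hE Φ h0 hT φ hφ hφ0 η δ hη hδ
  have hσ₁' : σ < σ₁ := hσlt.trans_le (min_le_left _ _)
  have hσ1 : σ < 1 := hσlt.trans_le ((min_le_right _ _).trans (min_le_left _ _))
  have hσA : σ < η₀ / A := hσlt.trans_le ((min_le_right _ _).trans (min_le_right _ _))
  obtain ⟨hsd, Hid⟩ := G1 σ hσ hσ₁'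
  obtain ⟨hρc, huc, hθc⟩ := PolynomialCompressionPDE.continuous_slices_zero hE hT
  have hid : ρ 0 = rhoLim (profileOf a₀ ha ha0) σ := Hid ρ θ u Φ hρc h0
  have h0T : (0 : ℝ) ∈ Set.Ico 0 T := ⟨le_rfl, hT⟩
  have hρpos : ∀ x, 0 < ρ 0 x := hE.density_pos 0 h0T
  have hθpos : ∀ x, 0 < θ 0 x := hE.temperature_pos 0 h0T
  have hband : ∀ x, ρ 0 x * σ ^ 3 < η₀ := by
    intro x
    have h1 : ρ 0 x < A := by
      rw [hid]
      exact DenseExcursionAtTimeZero.rhoLim_lt hsd x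
    have h3 : σ ^ 3 ≤ σ := by
      have h2 : σ ^ 2 ≤ 1 := by nlinarith
      nlinarith
    have hAσ : A * σ < η₀ := by rwa [lt_div_iff₀ hApos, mul_comm] at hσA
    calc ρ 0 x * σ ^ 3 ≤ ρ 0 x * σ := mul_le_mul_of_nonneg_left h3 (hρpos x).le
      _ ≤ A * σ := mul_le_mul_of_nonneg_right h1.le hσ.le
      _ < η₀ := hAσ
  -- the test function at `t = 0`
  have hφc : Continuous (φ 0) := (hφ.isSmooth_slice (Set.mem_univ (0 : ℝ))).continuous
  have hIφ0 : 0 ≤ ∫ x, φ 0 x := integral_nonneg (hφ0 0)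
  have hε₄pos : 0 < η / ((∫ x, φ 0 x) + 1) := by positivity
  have hε₄I : η / ((∫ x, φ 0 x) + 1) * ∫ x, φ 0 x < η := by
    rw [div_mul_eq_mul_div, div_lt_iff₀ (by positivity)]
    nlinarith
  -- the modulus and the uniform LLN
  obtain ⟨hHc, ε₃, hε₃, HM⟩ := initL_modulus hB hσ hρc huc hθc hρpos hθpos hband hε₄pos
  obtain ⟨r₀, hr₀, HU⟩ := initialLayer_uniformLLN hρc huc hθc Φ h0 hε₃ hδ
  refine ⟨r₀, hr₀, fun r hr hrr₀ => ?_⟩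
  obtain ⟨N₀, HN⟩ := HU r hr hrr₀
  refine ⟨N₀, fun N hN => ?_⟩
  obtain ⟨B, hPB, HB⟩ := HN N hN
  refine le_trans (measure_mono fun z hz => ?_) hPB
  by_contra hzB
  obtain ⟨hPc, hPx⟩ := HM N r ((Φ N).flow 0 z) (HB z hzB)
  -- the two boundary integrals are `η`-close
  have hi1 : Integrable fun x => Hs σ (rhoC r ((Φ N).flow 0 z) x) (thetaC r ((Φ N).flow 0 z) x) * φ 0 x :=
    integrable_of_continuous_T3 (hPc.mul hφc)
  have hi2 : Integrable fun x => Hs σ (ρ 0 x) (θ 0 x) * φ 0 x := integrable_of_continuous_T3 (hHc.mul hφc)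
  have hdiff : |bdry σ r (φ 0) (Φ N) z - ∫ x, Hs σ (ρ 0 x) (θ 0 x) * φ 0 x| ≤
      η / ((∫ x, φ 0 x) + 1) * ∫ x, φ 0 x := by
    unfold bdry
    rw [← integral_sub hi1 hi2, ← integral_const_mul, ← Real.norm_eq_abs]
    refine norm_integral_le_of_norm_le ((integrable_of_continuous_T3 hφc).const_mul _)
      (Eventually.of_forall fun x => ?_)
    rw [Real.norm_eq_abs, ← sub_mul, abs_mul, abs_of_nonneg (hφ0 0 x)]
    exact mul_le_mul_of_nonneg_right (hPx x).le (hφ0 0 x)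
  have hcon : ¬ ((∫ x : T3, Hs σ (ρ 0 x) (θ 0 x) * φ 0 x) < bdry σ r (φ 0) (Φ N) z - η) := by
    rw [abs_le] at hdiff
    push Not
    linarith [hdiff.1, hdiff.2]
  exact hcon hz

end Summit.AtomisticToContinuum.HydrodynamicLimit.Theorems.LocalSecondLawLedger

end
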